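import Summits.HubbardSuperconductivity.HubbardSuperconductivity.Theorems.NodalDiracTwistBridgeNodalToDWaveMomentumTube

/-!
# Route `NodalDiracTwist`, crux `BridgeNodalToDWave` (stmt-HubbardSuperconductivity-10395) —
# helper: under clause (I) of the nodal-Dirac package the crystal momentum of the sector ground
# state is the same at every twist of the open cell off the diagonal quartet

Line `birth`, lead c11 (`--supports stmt-HubbardSuperconductivity-10395`); sequel of
`…MomentumTube`, `…MomentumLocallyConstant` (p151426), `…RealMomentum` (p150357),
`…RealMomentumDiagonal` (p150906).  Clause (I) of the package at side `L` with locus parameter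
`c ∈ (0, π)`: the `(N, S^z = 0)` sector ground space of `H_L(U,φ)` has an orthogonal pair exactly at
the twists `(±c, ±c)` of the cell.  Proved here: `clauseI_translation_sign_eq_untwisted` (registered
sub-goal `stub_clauseIMomentumConstant`) — **for every twist `φ` of the open cell `(−π,π)²` off the
quartet, every sector ground state at `φ` has the same translation eigenvalues as any untwisted
sector ground state** (two-segment path `0 → (φ 0, 0) → φ`, or `0 → (0, φ 1) → φ` when `|φ 0| = c`,
each segment carrying a tube of uniqueness disks of radius
`½ min(π - |φ 0|, π - |φ 1|, c, |c - |φ i||)`, `sign_eq_of_tube`).  With `…RealMomentumDiagonal`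
(untwisted momentum `∈ {0, (π,π)}`) this is lead c9's audit item S3 in kernel-checked form: a
ground state as in the nodal-Dirac package carries ONE momentum `K₀ ∈ {0, (π,π)}` throughout the
punctured open twist cell.

Sources: Y. Hatsugai, J. Phys. Soc. Jpn. 75 (2006) 123601; T. Kato (1966) II §5.1; E. H. Lieb,
PRL 62 (1989) 1201 (sectors).  No new definitions, no named facts.
-/

-- the mandated namespace `Summit.<Summit>.<Problem>.Theorems` repeats `HubbardSuperconductivity`
set_option linter.dupNamespace false

noncomputable section

namespace Summit.HubbardSuperconductivity.HubbardSuperconductivity.Theorems.NodalDiracTwist.BridgeNodalToDWave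

open Matrix Literature.MathematicalPhysics.QuantumLattice Literature.Probability.LatticeModels HubbardWave0
open Summit.HubbardSuperconductivity.HubbardSuperconductivity.Theorems.NodalDiracTwist
open scoped ComplexOrder

section ClauseI

variable (L : ℕ) [NeZero L]

/-- **Path `0 → (φ 0, 0) → φ` (case `|φ 0| ≠ c`).**  Under clause (I) with `0 < c < π`, for a twist
`φ` of the open cell with `|φ 0| ≠ c`, every sector ground state at `φ` has the same `U_v`-eigenvalue
as every sector ground state at the untwisted point: both segments of the path carry a tube of
uniqueness disks of radius `ρ = ½ min(π - |φ 0|, π - |φ 1|, c, abs (c - |φ 0|))`. [folklore] -/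
theorem sign_eq_untwisted_of_abs_fst_ne {U : ℝ} {N : ℕ} {c : ℝ}
    (hI : ∀ φ : Fin 2 → ℝ, φ 0 ∈ Set.Ioc (-Real.pi) Real.pi → φ 1 ∈ Set.Ioc (-Real.pi) Real.pi →
      ((∃ ψ₁ ψ₂ : Fock (Orb (FermionTorus 2 L)),
        IsGroundStateInSector (spinTwistedHubbardTorus L U φ) N 0 ψ₁ ∧
        IsGroundStateInSector (spinTwistedHubbardTorus L U φ) N 0 ψ₂ ∧ star ψ₁ ⬝ᵥ ψ₂ = 0) ↔
        (|φ 0| = c ∧ |φ 1| = c)))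
    (hc0 : 0 < c) (hcπ : c < Real.pi) {φ : Fin 2 → ℝ} (hφ0 : |φ 0| < Real.pi) (hφ1 : |φ 1| < Real.pi)
    (hx : |φ 0| ≠ c) (v : TorusSite 2 L) {χ₀ χ : Fock (Orb (FermionTorus 2 L))} {a₀ a : ℂ}
    (hχ₀ : IsGroundStateInSector (spinTwistedHubbardTorus L U 0) N 0 χ₀)
    (hχ : IsGroundStateInSector (spinTwistedHubbardTorus L U φ) N 0 χ)
    (ha₀ : (fockTranslate v).val *ᵥ χ₀ = a₀ • χ₀) (ha : (fockTranslate v).val *ᵥ χ = a • χ) : a = a₀ := by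
  classical
  -- the tube radius
  have hgap : 0 < abs (c - |φ 0|) := abs_pos.2 (sub_ne_zero.2 (Ne.symm hx))
  set ρ : ℝ := min (min (Real.pi - |φ 0|) (Real.pi - |φ 1|)) (min c (abs (c - |φ 0|))) / 2 with hρdef
  have hm1 : min (min (Real.pi - |φ 0|) (Real.pi - |φ 1|)) (min c (abs (c - |φ 0|))) ≤ Real.pi - |φ 0| :=
    (min_le_left _ _).trans (min_le_left _ _)
  have hm2 : min (min (Real.pi - |φ 0|) (Real.pi - |φ 1|)) (min c (abs (c - |φ 0|))) ≤ Real.pi - |φ 1| :=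
    (min_le_left _ _).trans (min_le_right _ _)
  have hm3 : min (min (Real.pi - |φ 0|) (Real.pi - |φ 1|)) (min c (abs (c - |φ 0|))) ≤ c :=
    (min_le_right _ _).trans (min_le_left _ _)
  have hm4 : min (min (Real.pi - |φ 0|) (Real.pi - |φ 1|)) (min c (abs (c - |φ 0|))) ≤ abs (c - |φ 0|) :=
    (min_le_right _ _).trans (min_le_right _ _)
  have hmpos : 0 < min (min (Real.pi - |φ 0|) (Real.pi - |φ 1|)) (min c (abs (c - |φ 0|))) :=
    lt_min (lt_min (by linarith) (by linarith)) (lt_min hc0 hgap)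
  have hρ : 0 < ρ := by rw [hρdef]; linarith
  have hρ1 : |φ 0| + ρ < Real.pi := by rw [hρdef]; linarith
  have hρ2 : |φ 1| + ρ < Real.pi := by rw [hρdef]; linarith
  have hρ3 : ρ < c := by rw [hρdef]; linarith
  have hρ4 : ρ < abs (c - |φ 0|) := by rw [hρdef]; linarith
  have hρπ : ρ < Real.pi := by linarith [abs_nonneg (φ 0)]
  -- the corner `mid = (φ 0, 0)` and the two segments
  set mid : Fin 2 → ℝ := fun i => if i = 0 then φ 0 else 0 with hmid
  have hmid0 : mid 0 = φ 0 := by simp [hmid]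
  have hmid1 : mid 1 = 0 := by simp [hmid]
  have hseg1 : ∀ t : ℝ, ((0 : Fin 2 → ℝ) + t • (mid - 0)) 0 = t * φ 0 ∧
      ((0 : Fin 2 → ℝ) + t • (mid - 0)) 1 = 0 := fun t => by
    simp [hmid]
  have hseg2 : ∀ t : ℝ, (mid + t • (φ - mid)) 0 = φ 0 ∧ (mid + t • (φ - mid)) 1 = t * φ 1 := fun t => by
    simp [hmid]
  have habs_t : ∀ {t : ℝ}, 0 ≤ t → t ≤ 1 → ∀ x : ℝ, |t * x| ≤ |x| := fun ht0 ht1 x => by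
    rw [abs_mul, abs_of_nonneg ht0]
    exact mul_le_of_le_one_left (abs_nonneg x) ht1
  have hb1 : ∀ b : Fin 2 → ℝ, |b 1| = c → ρ ^ 2 < (b 1) ^ 2 := fun b hb => by
    rw [← sq_abs (b 1), hb]; exact pow_lt_pow_left₀ hρ3 hρ.le two_ne_zero
  have hb0 : ∀ b : Fin 2 → ℝ, |b 0| = c → ρ ^ 2 < (b 0 - φ 0) ^ 2 := fun b hb => by
    have h1 : ρ ^ 2 < (c - |φ 0|) ^ 2 := by
      rw [← sq_abs (c - |φ 0|)]; exact pow_lt_pow_left₀ hρ4 hρ.le two_ne_zero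
    have h2 := sq_abs_sub_abs_le (b 0) (φ 0)
    rw [hb] at h2
    exact lt_of_lt_of_le h1 h2
  -- tube conditions
  have htube1 : ∀ t : ℝ, 0 ≤ t → t ≤ 1 →
      |((0 : Fin 2 → ℝ) + t • (mid - 0)) 0| + ρ < Real.pi ∧ |((0 : Fin 2 → ℝ) + t • (mid - 0)) 1| + ρ < Real.pi ∧
      ∀ b : Fin 2 → ℝ, |b 0| = c → |b 1| = c →
        ρ ^ 2 < (b 0 - ((0 : Fin 2 → ℝ) + t • (mid - 0)) 0) ^ 2 + (b 1 - ((0 : Fin 2 → ℝ) + t • (mid - 0)) 1) ^ 2 := by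
    intro t ht0 ht1
    obtain ⟨e0, e1⟩ := hseg1 t
    rw [e0, e1]
    refine ⟨by linarith [habs_t ht0 ht1 (φ 0)], by rw [abs_zero]; linarith, fun b hb0' hb1' => ?_⟩
    rw [sub_zero]
    nlinarith [hb1 b hb1', sq_nonneg (b 0 - t * φ 0)]
  have htube2 : ∀ t : ℝ, 0 ≤ t → t ≤ 1 →
      |(mid + t • (φ - mid)) 0| + ρ < Real.pi ∧ |(mid + t • (φ - mid)) 1| + ρ < Real.pi ∧
      ∀ b : Fin 2 → ℝ, |b 0| = c → |b 1| = c →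
        ρ ^ 2 < (b 0 - (mid + t • (φ - mid)) 0) ^ 2 + (b 1 - (mid + t • (φ - mid)) 1) ^ 2 := by
    intro t ht0 ht1
    obtain ⟨e0, e1⟩ := hseg2 t
    rw [e0, e1]
    refine ⟨hρ1, by linarith [habs_t ht0 ht1 (φ 1)], fun b hb0' hb1' => ?_⟩
    nlinarith [hb0 b hb0', sq_nonneg (b 1 - t * φ 1)]
  -- a ground state at the corner and its eigenvalue
  have hp : ∃ s : Finset (Orb (FermionTorus 2 L)), s.card = N ∧ (upPart s).card = (downPart s).card := by
    by_contra hp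
    push Not at hp
    obtain ⟨hmem, hne, -⟩ := hχ₀
    exact hne (funext fun s => (mem_szSector_zero_iff_coord N _).1 hmem s fun h => hp s h.1 h.2)
  obtain ⟨⟨χm, hmK, hm0, hme⟩, -⟩ := sector_groundState (spinTwistedHubbardTorus L U mid)
    (spinTwistedHubbardTorus_isHermitian L U mid)
    (fun s : Finset (Orb (FermionTorus 2 L)) => s.card = N ∧ (upPart s).card = (downPart s).card)
    hp (fun s s' hs hs' => spinTwistedHubbardTorus_apply_eq_zero L U mid N s s' hs hs')
    (szSector N 0) (mem_szSector_zero_iff_coord N)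
  have hχm : IsGroundStateInSector (spinTwistedHubbardTorus L U mid) N 0 χm := ⟨hmK, hm0, hme⟩
  -- uniqueness at the corner (disk about `mid` = the `t = 0` disk of segment 2)
  have hmid_eq : mid + (0 : ℝ) • (φ - mid) = mid := by rw [zero_smul, add_zero]
  have huniq_mid : ∀ χ'', IsGroundStateInSector (spinTwistedHubbardTorus L U mid) N 0 χ'' →
      ∃ z : ℂ, χ'' = z • χm := fun χ'' h'' => by
    have hd := disk_unique_of_clauseI L hI hρ.le (hmid_eq ▸ (htube2 0 le_rfl zero_le_one).1)
      (hmid_eq ▸ (htube2 0 le_rfl zero_le_one).2.1) (hmid_eq ▸ (htube2 0 le_rfl zero_le_one).2.2)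
      mid (by rw [sub_self, sub_self]; nlinarith [sq_nonneg ρ]) χm χ'' hχm h''
    exact hd
  obtain ⟨am, ham⟩ := exists_fockTranslate_mulVec_eq_smul L hχm huniq_mid v
  -- segment 1: `a₀ = am`; segment 2: `am = a`
  have h1 : a₀ = am := sign_eq_of_tube L hI 0 mid hρ htube1 v hχ₀ hχm ha₀ ham
  have h2 : am = a := sign_eq_of_tube L hI mid φ hρ htube2 v hχm hχ ham ha
  rw [h1, h2]

/-- **Path `0 → (0, φ 1) → φ` (case `|φ 1| ≠ c`)**, the mirror image of
`sign_eq_untwisted_of_abs_fst_ne`. [folklore] -/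
theorem sign_eq_untwisted_of_abs_snd_ne {U : ℝ} {N : ℕ} {c : ℝ}
    (hI : ∀ φ : Fin 2 → ℝ, φ 0 ∈ Set.Ioc (-Real.pi) Real.pi → φ 1 ∈ Set.Ioc (-Real.pi) Real.pi →
      ((∃ ψ₁ ψ₂ : Fock (Orb (FermionTorus 2 L)),
        IsGroundStateInSector (spinTwistedHubbardTorus L U φ) N 0 ψ₁ ∧
        IsGroundStateInSector (spinTwistedHubbardTorus L U φ) N 0 ψ₂ ∧ star ψ₁ ⬝ᵥ ψ₂ = 0) ↔
        (|φ 0| = c ∧ |φ 1| = c)))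
    (hc0 : 0 < c) (hcπ : c < Real.pi) {φ : Fin 2 → ℝ} (hφ0 : |φ 0| < Real.pi) (hφ1 : |φ 1| < Real.pi)
    (hy : |φ 1| ≠ c) (v : TorusSite 2 L) {χ₀ χ : Fock (Orb (FermionTorus 2 L))} {a₀ a : ℂ}
    (hχ₀ : IsGroundStateInSector (spinTwistedHubbardTorus L U 0) N 0 χ₀)
    (hχ : IsGroundStateInSector (spinTwistedHubbardTorus L U φ) N 0 χ)
    (ha₀ : (fockTranslate v).val *ᵥ χ₀ = a₀ • χ₀) (ha : (fockTranslate v).val *ᵥ χ = a • χ) : a = a₀ := by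
  classical
  have hgap : 0 < abs (c - |φ 1|) := abs_pos.2 (sub_ne_zero.2 (Ne.symm hy))
  set ρ : ℝ := min (min (Real.pi - |φ 0|) (Real.pi - |φ 1|)) (min c (abs (c - |φ 1|))) / 2 with hρdef
  have hm1 : min (min (Real.pi - |φ 0|) (Real.pi - |φ 1|)) (min c (abs (c - |φ 1|))) ≤ Real.pi - |φ 0| :=
    (min_le_left _ _).trans (min_le_left _ _)
  have hm2 : min (min (Real.pi - |φ 0|) (Real.pi - |φ 1|)) (min c (abs (c - |φ 1|))) ≤ Real.pi - |φ 1| :=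
    (min_le_left _ _).trans (min_le_right _ _)
  have hm3 : min (min (Real.pi - |φ 0|) (Real.pi - |φ 1|)) (min c (abs (c - |φ 1|))) ≤ c :=
    (min_le_right _ _).trans (min_le_left _ _)
  have hm4 : min (min (Real.pi - |φ 0|) (Real.pi - |φ 1|)) (min c (abs (c - |φ 1|))) ≤ abs (c - |φ 1|) :=
    (min_le_right _ _).trans (min_le_right _ _)
  have hmpos : 0 < min (min (Real.pi - |φ 0|) (Real.pi - |φ 1|)) (min c (abs (c - |φ 1|))) :=
    lt_min (lt_min (by linarith) (by linarith)) (lt_min hc0 hgap)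
  have hρ : 0 < ρ := by rw [hρdef]; linarith
  have hρ1 : |φ 0| + ρ < Real.pi := by rw [hρdef]; linarith
  have hρ2 : |φ 1| + ρ < Real.pi := by rw [hρdef]; linarith
  have hρ3 : ρ < c := by rw [hρdef]; linarith
  have hρ4 : ρ < abs (c - |φ 1|) := by rw [hρdef]; linarith
  -- the corner `mid = (0, φ 1)` and the two segments
  set mid : Fin 2 → ℝ := fun i => if i = 0 then 0 else φ 1 with hmid
  have hseg1 : ∀ t : ℝ, ((0 : Fin 2 → ℝ) + t • (mid - 0)) 0 = 0 ∧
      ((0 : Fin 2 → ℝ) + t • (mid - 0)) 1 = t * φ 1 := fun t => by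
    simp [hmid]
  have hseg2 : ∀ t : ℝ, (mid + t • (φ - mid)) 0 = t * φ 0 ∧ (mid + t • (φ - mid)) 1 = φ 1 := fun t => by
    simp [hmid]
  have habs_t : ∀ {t : ℝ}, 0 ≤ t → t ≤ 1 → ∀ x : ℝ, |t * x| ≤ |x| := fun ht0 ht1 x => by
    rw [abs_mul, abs_of_nonneg ht0]
    exact mul_le_of_le_one_left (abs_nonneg x) ht1
  have hb0 : ∀ b : Fin 2 → ℝ, |b 0| = c → ρ ^ 2 < (b 0) ^ 2 := fun b hb => by
    rw [← sq_abs (b 0), hb]; exact pow_lt_pow_left₀ hρ3 hρ.le two_ne_zero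
  have hb1 : ∀ b : Fin 2 → ℝ, |b 1| = c → ρ ^ 2 < (b 1 - φ 1) ^ 2 := fun b hb => by
    have h1 : ρ ^ 2 < (c - |φ 1|) ^ 2 := by
      rw [← sq_abs (c - |φ 1|)]; exact pow_lt_pow_left₀ hρ4 hρ.le two_ne_zero
    have h2 := sq_abs_sub_abs_le (b 1) (φ 1)
    rw [hb] at h2
    exact lt_of_lt_of_le h1 h2
  have htube1 : ∀ t : ℝ, 0 ≤ t → t ≤ 1 →
      |((0 : Fin 2 → ℝ) + t • (mid - 0)) 0| + ρ < Real.pi ∧ |((0 : Fin 2 → ℝ) + t • (mid - 0)) 1| + ρ < Real.pi ∧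
      ∀ b : Fin 2 → ℝ, |b 0| = c → |b 1| = c →
        ρ ^ 2 < (b 0 - ((0 : Fin 2 → ℝ) + t • (mid - 0)) 0) ^ 2 + (b 1 - ((0 : Fin 2 → ℝ) + t • (mid - 0)) 1) ^ 2 := by
    intro t ht0 ht1
    obtain ⟨e0, e1⟩ := hseg1 t
    rw [e0, e1]
    refine ⟨by rw [abs_zero]; linarith [abs_nonneg (φ 0)], by linarith [habs_t ht0 ht1 (φ 1)],
      fun b hb0' hb1' => ?_⟩
    rw [sub_zero]
    nlinarith [hb0 b hb0', sq_nonneg (b 1 - t * φ 1)]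
  have htube2 : ∀ t : ℝ, 0 ≤ t → t ≤ 1 →
      |(mid + t • (φ - mid)) 0| + ρ < Real.pi ∧ |(mid + t • (φ - mid)) 1| + ρ < Real.pi ∧
      ∀ b : Fin 2 → ℝ, |b 0| = c → |b 1| = c →
        ρ ^ 2 < (b 0 - (mid + t • (φ - mid)) 0) ^ 2 + (b 1 - (mid + t • (φ - mid)) 1) ^ 2 := by
    intro t ht0 ht1
    obtain ⟨e0, e1⟩ := hseg2 t
    rw [e0, e1]
    refine ⟨by linarith [habs_t ht0 ht1 (φ 0)], hρ2, fun b hb0' hb1' => ?_⟩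
    nlinarith [hb1 b hb1', sq_nonneg (b 0 - t * φ 0)]
  -- a ground state at the corner and its eigenvalue
  have hp : ∃ s : Finset (Orb (FermionTorus 2 L)), s.card = N ∧ (upPart s).card = (downPart s).card := by
    by_contra hp
    push Not at hp
    obtain ⟨hmem, hne, -⟩ := hχ₀
    exact hne (funext fun s => (mem_szSector_zero_iff_coord N _).1 hmem s fun h => hp s h.1 h.2)
  obtain ⟨⟨χm, hmK, hm0, hme⟩, -⟩ := sector_groundState (spinTwistedHubbardTorus L U mid)
    (spinTwistedHubbardTorus_isHermitian L U mid)
    (fun s : Finset (Orb (FermionTorus 2 L)) => s.card = N ∧ (upPart s).card = (downPart s).card)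
    hp (fun s s' hs hs' => spinTwistedHubbardTorus_apply_eq_zero L U mid N s s' hs hs')
    (szSector N 0) (mem_szSector_zero_iff_coord N)
  have hχm : IsGroundStateInSector (spinTwistedHubbardTorus L U mid) N 0 χm := ⟨hmK, hm0, hme⟩
  have hmid_eq : mid + (0 : ℝ) • (φ - mid) = mid := by rw [zero_smul, add_zero]
  have huniq_mid : ∀ χ'', IsGroundStateInSector (spinTwistedHubbardTorus L U mid) N 0 χ'' →
      ∃ z : ℂ, χ'' = z • χm := fun χ'' h'' => by
    have hd := disk_unique_of_clauseI L hI hρ.le (hmid_eq ▸ (htube2 0 le_rfl zero_le_one).1)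
      (hmid_eq ▸ (htube2 0 le_rfl zero_le_one).2.1) (hmid_eq ▸ (htube2 0 le_rfl zero_le_one).2.2)
      mid (by rw [sub_self, sub_self]; nlinarith [sq_nonneg ρ]) χm χ'' hχm h''
    exact hd
  obtain ⟨am, ham⟩ := exists_fockTranslate_mulVec_eq_smul L hχm huniq_mid v
  have h1 : a₀ = am := sign_eq_of_tube L hI 0 mid hρ htube1 v hχ₀ hχm ha₀ ham
  have h2 : am = a := sign_eq_of_tube L hI mid φ hρ htube2 v hχm hχ ham ha
  rw [h1, h2]

/-- **Under clause (I), the crystal momentum of the sector ground state is the same at every twist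
of the open cell off the diagonal quartet as at the untwisted point.**  If the `(N, S^z = 0)`
sector ground space of `H_L(U,φ)` has an orthogonal pair exactly at the twists `(±c, ±c)` of the cell
(`0 < c < π`), then for every twist `φ` with `|φ 0| < π`, `|φ 1| < π`, not in the quartet, every
translation `U_v`, every sector ground state `χ` at `φ` and `χ₀` at `0`: `U_v χ = a χ` and
`U_v χ₀ = a₀ χ₀` imply `a = a₀` (both are signs, `fockTranslate_mulVec_eq_self_or_eq_neg`; the
untwisted one is `(0,0)` or `(π,π)`-like, `hubbardTorus_momentum_zero_or_pi_pi`). Hatsugai (2006);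
Kato (1966) II §5.1. [folklore] -/
theorem clauseI_translation_sign_eq_untwisted {U : ℝ} {N : ℕ} {c : ℝ}
    (hI : ∀ φ : Fin 2 → ℝ, φ 0 ∈ Set.Ioc (-Real.pi) Real.pi → φ 1 ∈ Set.Ioc (-Real.pi) Real.pi →
      ((∃ ψ₁ ψ₂ : Fock (Orb (FermionTorus 2 L)),
        IsGroundStateInSector (spinTwistedHubbardTorus L U φ) N 0 ψ₁ ∧
        IsGroundStateInSector (spinTwistedHubbardTorus L U φ) N 0 ψ₂ ∧ star ψ₁ ⬝ᵥ ψ₂ = 0) ↔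
        (|φ 0| = c ∧ |φ 1| = c)))
    (hc0 : 0 < c) (hcπ : c < Real.pi) {φ : Fin 2 → ℝ} (hφ0 : |φ 0| < Real.pi) (hφ1 : |φ 1| < Real.pi)
    (hoff : ¬ (|φ 0| = c ∧ |φ 1| = c)) (v : TorusSite 2 L) {χ₀ χ : Fock (Orb (FermionTorus 2 L))}
    {a₀ a : ℂ} (hχ₀ : IsGroundStateInSector (spinTwistedHubbardTorus L U 0) N 0 χ₀)
    (hχ : IsGroundStateInSector (spinTwistedHubbardTorus L U φ) N 0 χ)
    (ha₀ : (fockTranslate v).val *ᵥ χ₀ = a₀ • χ₀) (ha : (fockTranslate v).val *ᵥ χ = a • χ) : a = a₀ := by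
  by_cases hx : |φ 0| = c
  · have hy : |φ 1| ≠ c := fun h => hoff ⟨hx, h⟩
    exact sign_eq_untwisted_of_abs_snd_ne L hI hc0 hcπ hφ0 hφ1 hy v hχ₀ hχ ha₀ ha
  · exact sign_eq_untwisted_of_abs_fst_ne L hI hc0 hcπ hφ0 hφ1 hx v hχ₀ hχ ha₀ ha

/-- **Registered sub-goal `stub_clauseIMomentumConstant` of crux stmt-HubbardSuperconductivity-10395**
(lead c11, line `birth`; structural input to stub C): the statement of
`clauseI_translation_sign_eq_untwisted` with all binders explicit and all names fully qualified —
under clause (I) of the nodal-Dirac package the crystal momentum of the sector ground state at any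
twist of the open cell off the quartet equals that of the untwisted ground state.
Hatsugai (2006); Kato (1966) II §5.1. [folklore] -/
theorem stub_clauseIMomentumConstant : ∀ (L : ℕ) [NeZero L] (U : ℝ) (N : ℕ) (c : ℝ), (∀ φ : Fin 2 → ℝ, φ 0 ∈ Set.Ioc (-Real.pi) Real.pi → φ 1 ∈ Set.Ioc (-Real.pi) Real.pi → ((∃ ψ₁ ψ₂ : Literature.MathematicalPhysics.QuantumLattice.Fock (Literature.MathematicalPhysics.QuantumLattice.Orb (Literature.MathematicalPhysics.QuantumLattice.FermionTorus 2 L)), Literature.MathematicalPhysics.QuantumLattice.IsGroundStateInSector (Literature.MathematicalPhysics.QuantumLattice.spinTwistedHubbardTorus L U φ) N 0 ψ₁ ∧ Literature.MathematicalPhysics.QuantumLattice.IsGroundStateInSector (Literature.MathematicalPhysics.QuantumLattice.spinTwistedHubbardTorus L U φ) N 0 ψ₂ ∧ star ψ₁ ⬝ᵥ ψ₂ = 0) ↔ (|φ 0| = c ∧ |φ 1| = c))) → 0 < c → c < Real.pi → ∀ φ : Fin 2 → ℝ, |φ 0| < Real.pi → |φ 1| < Real.pi → ¬ (|φ 0|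 = c ∧ |φ 1| = c) → ∀ (v : Literature.Probability.LatticeModels.TorusSite 2 L) (χ₀ χ : Literature.MathematicalPhysics.QuantumLattice.Fock (Literature.MathematicalPhysics.QuantumLattice.Orb (Literature.MathematicalPhysics.QuantumLattice.FermionTorus 2 L))) (a₀ a : ℂ), Literature.MathematicalPhysics.QuantumLattice.IsGroundStateInSector (Literature.MathematicalPhysics.QuantumLattice.spinTwistedHubbardTorus L U 0) N 0 χ₀ → Literature.MathematicalPhysics.QuantumLattice.IsGroundStateInSector (Literature.MathematicalPhysics.QuantumLattice.spinTwistedHubbardTorus L U φ) N 0 χ → Matrix.mulVec (Literature.MathematicalPhysics.QuantumLattice.fockTranslate v).val χ₀ = a₀ • χ₀ → Matrix.mulVec (Literature.MathematicalPhysics.QuantumLattice.fockTranslate v).val χ = a • χ → a = a₀ :=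
  fun L _ _ _ _ hI hc0 hcπ _ hφ0 hφ1 hoff v _ _ _ _ hχ₀ hχ ha₀ ha =>
    clauseI_translation_sign_eq_untwisted L hI hc0 hcπ hφ0 hφ1 hoff v hχ₀ hχ ha₀ ha

end ClauseI

end Summit.HubbardSuperconductivity.HubbardSuperconductivity.Theorems.NodalDiracTwist.BridgeNodalToDWave

end
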